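import Literature.Analysis.FluidPDE.NSSerrinUniqueness
import Literature.Analysis.FluidPDE.WeakSolutionH1Test
import Literature.Analysis.FluidPDE.TrilinearSkew
import Literature.Analysis.FluidPDE.NSGaldiVorticityL2
import Literature.Analysis.FluidPDE.LerayHopfRestartEverywhere
import HarnessLib

/-!
# Lions' energy equality in `L⁴(0,T; L⁴)` by Serrin's doubling argument

Analysis/FluidPDE support file in the discharge programme of the named fact
`Literature.Analysis.FluidPDE.galdi_energy_equality` (Galdi 2019, Proc. AMS 147, Thm. 1.1), layer
`Literature.Analysis.FluidPDE.lions_energy_equality_L4` (Lions 1960; Sohr 2001, Thm. V.1.4.1 with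
`s = q = 4`, `n = 3`): the energy *equality* for weak solutions in `L⁴(0,T; L⁴)`.

* `Literature.Analysis.FluidPDE.lions_identity` (`dim E = 3`): for a weak solution `u` of the
  unforced Navier–Stokes system on `E × [0,T)` with datum `u₀ = u(0) ∈ L²`, in `L^∞(0,T; L²)`,
  with every slice in `L²`, bounded by `M` and weakly divergence free, weakly `L²`-continuous
  on `[0,T]` (the representative supplied by
  `IsWeakNSSolutionOn.exists_weaklyContinuousOn_version`), in `L⁴(0,T; L⁴)`, and with a jointly
  measurable weak-gradient witness `Gu` of finite dissipation:
  `‖u(t)‖₂² = ‖u₀‖₂² - 2ν ∫₀ᵗ Σᵢ ‖Gu(s) eᵢ‖₂² ds` for **every** `t ∈ (0,T]`.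

Proof (Serrin 1963, §4, as organised in the tree for the Serrin–Prodi uniqueness theorem,
`FluidPDE/NSSerrinUniqueness`, here with both solutions equal to `u`): the abstract doubling
identity `Literature.Analysis.FunctionSpaces.doubling_identity` for `Q(s,σ) = ⟨u(s), u(σ)⟩`,
whose one-sided representations are the `H¹_σ` time-slice identities of `u` tested with the
slices `u(σ) ∈ H¹_σ` (`IsWeakNSSolutionOn.inner_weakGrad_test_eq_of_continuousOn`, a.e. `σ`);
the boundary limits come from weak `L²` continuity; the gradient bulk terms converge to
`-ν∫₀ᵗ|∇u|²` each (`tendsto_grad_of_dissipation`, the `L²`–`L²` mollified pairing limit of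
`TimeMollification`), and the trilinear bulk terms (`tendsto_tri_L4`: after the frame expansion
`⟪G a, a⟫ = Σᵢ ⟪⟪a,eᵢ⟫ a, G eᵢ⟫` again `L²`–`L²` pairings, `|u|² ∈ L²(Q_T)`) converge to
`∫₀ᵗ b(u,u,u) ds = 0` (`integral_inner_weakGrad_apply_self_eq_zero`, `L⁴ × L⁴ × L²`). The
`g`-side bulk integrand is the swap of the `f`-side one by the evenness of the kernel. No new
definitions.

## Mathlib / tree search

No Navier–Stokes content in Mathlib. Tree: `FunctionSpaces/TimeDoubling`, `TimeMollification`
(`tendsto_integral_normed_mul_integral_inner`), `FluidPDE/NSSerrinUniqueness` (skeleton of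
`CrossData.cross_identity`, `integrable_sq_normed_mul_integral_inner`, `inner_apply_eq_sum_frame`),
`NSSerrinEstimates` (`integrable_sq_grad`, `stronglyMeasurable_integral_inner_apply`),
`WeakSolutionH1Test` (`inner_weakGrad_test_eq_of_continuousOn`, `integrableOn_weakFlux_of_L4`,
`lintegral_weight_lt_top_of_L4`), `LerayHopfH1Test` (`enorm_weakFlux_sub_le`), `TrilinearSkew`.

## References

* J.-L. Lions, *Sur la régularité et l'unicité des solutions turbulentes des équations de Navier
  Stokes*, Rend. Sem. Mat. Univ. Padova 30 (1960), 16–23.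
* H. Sohr, *The Navier–Stokes equations*, Birkhäuser 2001, Ch. V, Thm. 1.4.1. Bib key `Sohr2001`.
* J. Serrin, *The initial value problem for the Navier–Stokes equations*, in: Nonlinear Problems,
  Univ. Wisconsin Press 1963, §4. Bib key `Serrin1963`.
* G. P. Galdi, Proc. AMS 147 (2019), Thm. 1.1 (the fact served). Bib key `Galdi2018`.
-/

noncomputable section

open MeasureTheory TopologicalSpace Set Function Filter Topology InnerProductSpace
  ContinuousLinearMap Metric
open scoped RealInnerProductSpace ENNReal NNReal Convolution

namespace Literature.Analysis.FluidPDE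

variable {E : Type*} [NormedAddCommGroup E] [InnerProductSpace ℝ E] [FiniteDimensional ℝ E]
  [MeasurableSpace E] [BorelSpace E]

/-! ### `L⁴` bookkeeping on the slab -/

section L4

variable {T : ℝ} {u : ℝ → E → E} {ut : ℝ × E → E}

/-- `L⁴(0,T; L⁴)` gives `∫₀ᵀ ‖u(s)‖₄² ds < ∞` on a bounded time interval. [folklore] -/
theorem lintegral_eLpNorm_four_sq_lt_top_of_memLqLp (h4 : MemLqLp 4 4 u (Ioo 0 T)) :
    ∫⁻ s in Ioo 0 T, eLpNorm (u s) 4 volume ^ (2 : ℝ) < ⊤ :=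
  lintegral_rpow_eLpNorm_lt_top
    (by rw [Real.volume_Ioo]; exact ENNReal.ofReal_ne_top) h4 (by norm_num)
    (by rw [show (2 : ℝ) = ((2 : ℝ≥0∞)).toReal by norm_num, ENNReal.ofReal_toReal (by norm_num)]; norm_num)

/-- A jointly measurable version of an `L⁴` function on the slab is in `L⁴` of the slab. [folklore] -/
theorem eLpNorm_version_four_lt_top
    (hum : AEStronglyMeasurable (uncurry u) ((volume.restrict (Ioo 0 T)).prod (volume : Measure E)))
    (h4 : MemLqLp 4 4 u (Ioo 0 T))
    (hut : uncurry u =ᵐ[(volume.restrict (Ioo 0 T)).prod (volume : Measure E)] ut) :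
    eLpNorm ut 4 ((volume.restrict (Ioo 0 T)).prod (volume : Measure E)) < ⊤ := by
  rw [← eLpNorm_congr_ae hut]
  exact eLpNorm_uncurry_lt_top_of_memLqLp_four hum h4

omit [FiniteDimensional ℝ E] [BorelSpace E] in
/-- The quadratic frame fields `(s,x) ↦ ⟪ũ, eᵢ⟫ ũ` of an `L⁴` field are in `L²` of the slab.
[folklore] -/
theorem eLpNorm_two_inner_smul_self_lt_top {μ : Measure (ℝ × E)}
    (h4 : eLpNorm ut 4 μ < ⊤) (e : E) (he : ‖e‖ = 1) :
    eLpNorm (fun z => ⟪ut z, e⟫ • ut z) 2 μ < ⊤ := by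
  have hle : ∀ z, ‖⟪ut z, e⟫ • ut z‖ ≤ ‖(fun z => ‖ut z‖ ^ (2 : ℝ)) z‖ := fun z => by
    rw [norm_smul, Real.norm_eq_abs, Real.norm_of_nonneg (Real.rpow_nonneg (norm_nonneg _) _),
      Real.rpow_two, sq]
    exact mul_le_mul_of_nonneg_right ((abs_real_inner_le_norm _ _).trans (by rw [he, mul_one]))
      (norm_nonneg _)
  refine lt_of_le_of_lt (eLpNorm_mono hle) ?_
  rw [eLpNorm_norm_rpow ut (by norm_num : (0 : ℝ) < 2)]
  have h24 : (2 : ℝ≥0∞) * ENNReal.ofReal 2 = 4 := by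
    rw [show ENNReal.ofReal 2 = 2 by norm_num]; norm_num
  rw [h24]
  exact ENNReal.rpow_lt_top_of_nonneg (by norm_num) h4.ne

end L4

/-! ### The trilinear bulk term: integrability on the time square and the mollified limit -/

section Trilinear

variable {T : ℝ} {u : ℝ → E → E} {ut : ℝ × E → E} {Gu : ℝ → E → E →L[ℝ] E}

/-- Frame expansion of the trilinear density through the version:
`∫ ⟪G(σ) ũ(s), ũ(s)⟫ = Σᵢ ∫ ⟪⟪ũ(s), eᵢ⟫ ũ(s), G(σ) eᵢ⟫`, given integrability of the summands.
[folklore] -/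
theorem integral_inner_apply_self_eq_sum_frame (G : E → E →L[ℝ] E) (w : E → E)
    (hint : ∀ i, Integrable (fun x => ⟪⟪w x, stdOrthonormalBasis ℝ E i⟫ • w x,
      G x (stdOrthonormalBasis ℝ E i)⟫) (volume : Measure E)) :
    ∫ x, ⟪G x (w x), w x⟫ = ∑ i, ∫ x, ⟪⟪w x, stdOrthonormalBasis ℝ E i⟫ • w x,
      G x (stdOrthonormalBasis ℝ E i)⟫ := by
  have h : ∀ x, ⟪G x (w x), w x⟫ = ∑ i, ⟪⟪w x, stdOrthonormalBasis ℝ E i⟫ • w x,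
      G x (stdOrthonormalBasis ℝ E i)⟫ := fun x => inner_apply_eq_sum_frame (G x) (w x) (w x)
  simp_rw [h]
  exact integral_finsetSum _ fun i _ => hint i

/-- **The trilinear bulk limit for `u ∈ L⁴(Q_T)`.**
`∫∫ ρₙ(s-σ) ∫⟪Gu(σ) ũ(s), ũ(s)⟫ dσ ds → ∫₀ᵗ ∫ ⟪Gu(s) ũ(s), ũ(s)⟫ ds` for a jointly measurable
`ũ ∈ L⁴` of the slab and a jointly measurable finite-dissipation gradient field `Gu`: after the
frame expansion `⟪G a, a⟫ = Σᵢ ⟪⟪a, eᵢ⟫ a, G eᵢ⟫` each summand is an `L²`–`L²` pairing on the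
slab (`|⟪ũ, eᵢ⟫ ũ| ≤ |ũ|² ∈ L²`, `|Gu eᵢ| ≤ |Gu| ∈ L²`), to which the mollified pairing limit of
`TimeMollification` applies (Serrin 1963, §4; Lions 1960 / Sohr 2001, Thm. V.1.4.1 for the
`L⁴` class). [cite: Serrin1963, §4] -/
theorem tendsto_tri_L4 {t : ℝ} (htT : t ≤ T) (hutm : StronglyMeasurable ut)
    (hut4 : eLpNorm ut 4 ((volume.restrict (Ioo 0 T)).prod (volume : Measure E)) < ⊤)
    (hGum : StronglyMeasurable (uncurry Gu))
    (hGu₂ : ∫⁻ t in Ioo 0 T, ∫⁻ x, ENNReal.ofReal (frobeniusNormSq (Gu t x)) < ⊤)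
    {φ : ℕ → ContDiffBump (0 : ℝ)} (hφ : Tendsto (fun n => (φ n).rOut) atTop (𝓝 0)) :
    Tendsto (fun n => ∫ p, (φ n).normed volume (p.2 - p.1) *
        (∫ x, ⟪Gu p.1 x (ut (p.2, x)), ut (p.2, x)⟫)
        ∂((volume.restrict (Ioo 0 t)).prod (volume.restrict (Ioo 0 t))))
      atTop (𝓝 (∫ s in Ioo 0 t, ∫ x, ⟪Gu s x (ut (s, x)), ut (s, x)⟫)) := by
  set b := stdOrthonormalBasis ℝ E with hb
  have hb1 : ∀ i, ‖b i‖ = 1 := fun i => b.orthonormal.1 i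
  have hGu₂t := lintegral_Ioo_mono_lt_top htT hGu₂
  have hmono : (volume.restrict (Ioo 0 t)).prod (volume : Measure E) ≤
      (volume.restrict (Ioo 0 T)).prod (volume : Measure E) :=
    Measure.prod_mono (Measure.restrict_mono (Ioo_subset_Ioo le_rfl htT) le_rfl) le_rfl
  have hut4t : eLpNorm ut 4 ((volume.restrict (Ioo 0 t)).prod (volume : Measure E)) < ⊤ :=
    lt_of_le_of_lt (eLpNorm_mono_measure _ hmono) hut4
  -- the components
  set Φ : Fin (Module.finrank ℝ E) → ℝ → E → E := fun i s x => ⟪ut (s, x), b i⟫ • ut (s, x) with hΦ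
  set A : Fin (Module.finrank ℝ E) → ℝ → E → E := fun i σ x => Gu σ x (b i) with hA
  have hΦm : ∀ i, StronglyMeasurable (uncurry (Φ i)) := fun i => by
    have h : StronglyMeasurable fun z : ℝ × E => ⟪ut z, b i⟫ • ut z :=
      (hutm.inner (𝕜 := ℝ) stronglyMeasurable_const).smul hutm
    exact h
  have hAm : ∀ i, StronglyMeasurable (uncurry (A i)) := fun i =>
    (ContinuousLinearMap.apply ℝ E (b i)).continuous.comp_stronglyMeasurable hGum
  have hΦ2 : ∀ i, eLpNorm (uncurry (Φ i)) 2 ((volume.restrict (Ioo 0 t)).prod (volume : Measure E)) < ⊤ :=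
    fun i => eLpNorm_two_inner_smul_self_lt_top hut4t (b i) (hb1 i)
  have hA2 : ∀ i, eLpNorm (uncurry (A i)) 2 ((volume.restrict (Ioo 0 t)).prod (volume : Measure E)) < ⊤ :=
    fun i => eLpNorm_grad_apply_prod_lt_top hGum hGu₂t (b i) (hb1 i)
  -- componentwise limits
  have hlim : ∀ i, Tendsto (fun n => ∫ p, (φ n).normed volume (p.2 - p.1) *
      (∫ x, ⟪Φ i p.2 x, A i p.1 x⟫) ∂((volume.restrict (Ioo 0 t)).prod (volume.restrict (Ioo 0 t))))
      atTop (𝓝 (∫ z, ⟪Φ i z.1 z.2, A i z.1 z.2⟫ ∂((volume.restrict (Ioo 0 t)).prod (volume : Measure E)))) :=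
    fun i => FunctionSpaces.tendsto_integral_normed_mul_integral_inner hφ (hAm i) (hΦm i) (hA2 i) (hΦ2 i)
  have hsum := tendsto_finsetSum Finset.univ fun i _ => hlim i
  -- slice integrability of the summands (everywhere in `(σ, s)` is not available; a.e. suffices)
  have hint : ∀ i, Integrable (fun z : ℝ × E => ⟪Φ i z.1 z.2, A i z.1 z.2⟫)
      ((volume.restrict (Ioo 0 t)).prod (volume : Measure E)) := fun i =>
    FunctionSpaces.integrable_inner_of_eLpNorm_two_lt_top (hΦm i).aestronglyMeasurable
      (hAm i).aestronglyMeasurable (hΦ2 i) (hA2 i)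
  -- identify the left-hand sides
  have hL : ∀ n, (∫ p, (φ n).normed volume (p.2 - p.1) * (∫ x, ⟪Gu p.1 x (ut (p.2, x)), ut (p.2, x)⟫)
      ∂((volume.restrict (Ioo 0 t)).prod (volume.restrict (Ioo 0 t)))) =
      ∑ i, ∫ p, (φ n).normed volume (p.2 - p.1) * (∫ x, ⟪Φ i p.2 x, A i p.1 x⟫)
        ∂((volume.restrict (Ioo 0 t)).prod (volume.restrict (Ioo 0 t))) := by
    intro n
    rw [← integral_finsetSum _ fun i _ =>
      integrable_sq_normed_mul_integral_inner (φ n) (hAm i) (hΦm i) (hA2 i) (hΦ2 i)]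
    refine integral_congr_ae ?_
    -- for a.e. `p`, the slices `x ↦ ⟪Φ i p.2 x, A i p.1 x⟫` are integrable
    have hsl : ∀ i, ∀ᵐ p ∂((volume.restrict (Ioo 0 t)).prod (volume.restrict (Ioo 0 t))),
        Integrable (fun x => ⟪Φ i p.2 x, A i p.1 x⟫) (volume : Measure E) := by
      intro i
      have hΦmem : MemLp (uncurry (Φ i)) 2 ((volume.restrict (Ioo 0 t)).prod (volume : Measure E)) :=
        ⟨(hΦm i).aestronglyMeasurable, hΦ2 i⟩
      have hAmem : MemLp (uncurry (A i)) 2 ((volume.restrict (Ioo 0 t)).prod (volume : Measure E)) :=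
        ⟨(hAm i).aestronglyMeasurable, hA2 i⟩
      have hs : ∀ᵐ s ∂(volume.restrict (Ioo 0 t)), MemLp (fun x => uncurry (Φ i) (s, x)) 2 (volume : Measure E) :=
        ae_memLp_slice_of_memLp_prod two_ne_zero ENNReal.ofNat_ne_top hΦmem
      have hσ : ∀ᵐ σ ∂(volume.restrict (Ioo 0 t)), MemLp (fun x => uncurry (A i) (σ, x)) 2 (volume : Measure E) :=
        ae_memLp_slice_of_memLp_prod two_ne_zero ENNReal.ofNat_ne_top hAmem
      filter_upwards [(Measure.quasiMeasurePreserving_snd (μ := volume.restrict (Ioo 0 t))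
        (ν := volume.restrict (Ioo 0 t))).ae hs, (Measure.quasiMeasurePreserving_fst
        (μ := volume.restrict (Ioo 0 t)) (ν := volume.restrict (Ioo 0 t))).ae hσ] with p hp2 hp1
      exact FunctionSpaces.integrable_inner_of_eLpNorm_two_lt_top hp2.1 hp1.1 hp2.2 hp1.2
    have hall := ae_all_iff.2 fun i => hsl i
    filter_upwards [hall] with p hp
    rw [← Finset.mul_sum, integral_inner_apply_self_eq_sum_frame (Gu p.1) (fun x => ut (p.2, x)) hp]
  -- identify the right-hand side
  have hR : (∑ i, ∫ z, ⟪Φ i z.1 z.2, A i z.1 z.2⟫ ∂((volume.restrict (Ioo 0 t)).prod (volume : Measure E))) =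
      ∫ s in Ioo 0 t, ∫ x, ⟪Gu s x (ut (s, x)), ut (s, x)⟫ := by
    have h1 : ∀ i, (∫ z, ⟪Φ i z.1 z.2, A i z.1 z.2⟫ ∂((volume.restrict (Ioo 0 t)).prod (volume : Measure E)))
        = ∫ s in Ioo 0 t, ∫ x, ⟪Φ i s x, A i s x⟫ := fun i =>
      integral_prod (fun z : ℝ × E => ⟪Φ i z.1 z.2, A i z.1 z.2⟫) (hint i)
    have h2 : ∀ i, Integrable (fun s => ∫ x, ⟪Φ i s x, A i s x⟫) (volume.restrict (Ioo 0 t)) :=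
      fun i => (hint i).integral_prod_left
    have h3 : ∀ᵐ s ∂(volume.restrict (Ioo 0 t)), ∀ i,
        Integrable (fun x => ⟪Φ i s x, A i s x⟫) (volume : Measure E) :=
      ae_all_iff.2 fun i => (hint i).prod_right_ae
    calc (∑ i, ∫ z, ⟪Φ i z.1 z.2, A i z.1 z.2⟫ ∂((volume.restrict (Ioo 0 t)).prod (volume : Measure E)))
        = ∑ i, ∫ s in Ioo 0 t, ∫ x, ⟪Φ i s x, A i s x⟫ := Finset.sum_congr rfl fun i _ => h1 i
      _ = ∫ s in Ioo 0 t, ∑ i, ∫ x, ⟪Φ i s x, A i s x⟫ := (integral_finsetSum _ fun i _ => h2 i).symm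
      _ = ∫ s in Ioo 0 t, ∫ x, ⟪Gu s x (ut (s, x)), ut (s, x)⟫ := by
          refine integral_congr_ae ?_
          filter_upwards [h3] with s hs
          exact (integral_inner_apply_self_eq_sum_frame (Gu s) (fun x => ut (s, x)) hs).symm
  rw [← hR]
  exact hsum.congr fun n => (hL n).symm

end Trilinear

/-! ### The gradient bulk limit (generic form of `CrossData.tendsto_grad`) -/

section Grad

variable {T : ℝ} {Gu Gv : ℝ → E → E →L[ℝ] E}

/-- **The gradient bulk limit** `∫∫ ρₙ(s-σ) Σᵢ⟨Gu(s)eᵢ, Gv(σ)eᵢ⟩ dσ ds → ∫₀ᵗ Σᵢ ⟨Gu eᵢ, Gv eᵢ⟩ ds`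
for two jointly measurable finite-dissipation gradient fields (the `L²`–`L²` pairing limit of
`TimeMollification`, componentwise; the accepted `CrossData.tendsto_grad` with its bookkeeping
bundle unpacked). [cite: Serrin1963, §4] -/
theorem tendsto_grad_of_dissipation {t : ℝ} (htT : t ≤ T)
    (hGum : StronglyMeasurable (uncurry Gu)) (hGvm : StronglyMeasurable (uncurry Gv))
    (hGu₂ : ∫⁻ t in Ioo 0 T, ∫⁻ x, ENNReal.ofReal (frobeniusNormSq (Gu t x)) < ⊤)
    (hGv₂ : ∫⁻ t in Ioo 0 T, ∫⁻ x, ENNReal.ofReal (frobeniusNormSq (Gv t x)) < ⊤)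
    {φ : ℕ → ContDiffBump (0 : ℝ)} (hφ : Tendsto (fun n => (φ n).rOut) atTop (𝓝 0)) :
    Tendsto (fun n => ∫ p, (φ n).normed volume (p.2 - p.1) *
        (∑ i, ∫ x, ⟪Gu p.2 x (stdOrthonormalBasis ℝ E i), Gv p.1 x (stdOrthonormalBasis ℝ E i)⟫)
        ∂((volume.restrict (Ioo 0 t)).prod (volume.restrict (Ioo 0 t))))
      atTop (𝓝 (∫ s in Ioo 0 t, ∑ i, ∫ x,
        ⟪Gu s x (stdOrthonormalBasis ℝ E i), Gv s x (stdOrthonormalBasis ℝ E i)⟫)) := by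
  set b := stdOrthonormalBasis ℝ E with hb
  have hb1 : ∀ i, ‖b i‖ = 1 := fun i => b.orthonormal.1 i
  have hGu₂t := lintegral_Ioo_mono_lt_top htT hGu₂
  have hGv₂t := lintegral_Ioo_mono_lt_top htT hGv₂
  set Φ : Fin (Module.finrank ℝ E) → ℝ → E → E := fun i s x => Gu s x (b i) with hΦ
  set A : Fin (Module.finrank ℝ E) → ℝ → E → E := fun i σ x => Gv σ x (b i) with hA
  have hΦm : ∀ i, StronglyMeasurable (uncurry (Φ i)) := fun i =>
    (ContinuousLinearMap.apply ℝ E (b i)).continuous.comp_stronglyMeasurable hGum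
  have hAm : ∀ i, StronglyMeasurable (uncurry (A i)) := fun i =>
    (ContinuousLinearMap.apply ℝ E (b i)).continuous.comp_stronglyMeasurable hGvm
  have hΦ2 : ∀ i, eLpNorm (uncurry (Φ i)) 2 ((volume.restrict (Ioo 0 t)).prod (volume : Measure E)) < ⊤ :=
    fun i => eLpNorm_grad_apply_prod_lt_top hGum hGu₂t (b i) (hb1 i)
  have hA2 : ∀ i, eLpNorm (uncurry (A i)) 2 ((volume.restrict (Ioo 0 t)).prod (volume : Measure E)) < ⊤ :=
    fun i => eLpNorm_grad_apply_prod_lt_top hGvm hGv₂t (b i) (hb1 i)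
  have hlim : ∀ i, Tendsto (fun n => ∫ p, (φ n).normed volume (p.2 - p.1) *
      (∫ x, ⟪Φ i p.2 x, A i p.1 x⟫) ∂((volume.restrict (Ioo 0 t)).prod (volume.restrict (Ioo 0 t))))
      atTop (𝓝 (∫ z, ⟪Φ i z.1 z.2, A i z.1 z.2⟫ ∂((volume.restrict (Ioo 0 t)).prod (volume : Measure E)))) :=
    fun i => FunctionSpaces.tendsto_integral_normed_mul_integral_inner hφ (hAm i) (hΦm i) (hA2 i) (hΦ2 i)
  have hsum := tendsto_finsetSum Finset.univ fun i _ => hlim i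
  have hL : ∀ n, (∫ p, (φ n).normed volume (p.2 - p.1) * (∑ i, ∫ x, ⟪Gu p.2 x (b i), Gv p.1 x (b i)⟫)
      ∂((volume.restrict (Ioo 0 t)).prod (volume.restrict (Ioo 0 t)))) =
      ∑ i, ∫ p, (φ n).normed volume (p.2 - p.1) * (∫ x, ⟪Φ i p.2 x, A i p.1 x⟫)
        ∂((volume.restrict (Ioo 0 t)).prod (volume.restrict (Ioo 0 t))) := by
    intro n
    rw [← integral_finsetSum _ fun i _ =>
      integrable_sq_normed_mul_integral_inner (φ n) (hAm i) (hΦm i) (hA2 i) (hΦ2 i)]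
    congr 1; ext p
    rw [Finset.mul_sum]
  have hint : ∀ i, Integrable (fun z : ℝ × E => ⟪Φ i z.1 z.2, A i z.1 z.2⟫)
      ((volume.restrict (Ioo 0 t)).prod (volume : Measure E)) := fun i =>
    FunctionSpaces.integrable_inner_of_eLpNorm_two_lt_top (hΦm i).aestronglyMeasurable
      (hAm i).aestronglyMeasurable (hΦ2 i) (hA2 i)
  have hR : (∑ i, ∫ z, ⟪Φ i z.1 z.2, A i z.1 z.2⟫ ∂((volume.restrict (Ioo 0 t)).prod (volume : Measure E))) =
      ∫ s in Ioo 0 t, ∑ i, ∫ x, ⟪Gu s x (b i), Gv s x (b i)⟫ := by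
    rw [integral_finsetSum _ fun i _ => (hint i).integral_prod_left]
    refine Finset.sum_congr rfl fun i _ => ?_
    rw [integral_prod _ (hint i)]
  rw [← hR]
  refine hsum.congr fun n => (hL n).symm

end Grad

/-! ### Lions' identity for the weakly continuous representative -/

section Lions

variable {T ν : ℝ} {u₀ : E → E} {u : ℝ → E → E} {Gu : ℝ → E → E →L[ℝ] E} {ut : ℝ × E → E}

/-- `|∫⟪v, g⟫| ≤ M²` for two fields with `‖·‖₂ ≤ M`. [folklore] -/
theorem abs_integral_inner_le_sq_of_eLpNorm_le {v g : E → E} {M : ℝ} (hM : 0 ≤ M)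
    (hv : MemLp v 2 volume) (hg : MemLp g 2 volume)
    (hvM : eLpNorm v 2 volume ≤ ENNReal.ofReal M) (hgM : eLpNorm g 2 volume ≤ ENNReal.ofReal M) :
    |∫ x, ⟪v x, g x⟫| ≤ M ^ 2 := by
  have h := abs_integral_inner_le_kineticEnergy_add hv hg
  rw [kineticEnergy_eq_half_toReal_eLpNorm_sq hv, kineticEnergy_eq_half_toReal_eLpNorm_sq hg] at h
  have hv' : (eLpNorm v 2 volume).toReal ≤ M := ENNReal.toReal_le_of_le_ofReal hM hvM
  have hg' : (eLpNorm g 2 volume).toReal ≤ M := ENNReal.toReal_le_of_le_ofReal hM hgM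
  have hv2 : (eLpNorm v 2 volume).toReal ^ 2 ≤ M ^ 2 := pow_le_pow_left₀ ENNReal.toReal_nonneg hv' 2
  have hg2 : (eLpNorm g 2 volume).toReal ^ 2 ≤ M ^ 2 := pow_le_pow_left₀ ENNReal.toReal_nonneg hg' 2
  linarith

/-- **Lions' identity for a weakly continuous `L⁴(Q_T)` weak solution** (Lions 1960; Sohr 2001,
Thm. V.1.4.1 with `s = q = 4`, `n = 3`, identity (1.4.3) from `t₀ = 0`; proof by Serrin's doubling
of the time variable, Serrin 1963, §4). Let `dim E = 3`, `ν > 0`, `T > 0`, and let `u` be a weak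
solution of the unforced Navier–Stokes system on `E × [0,T)` with datum `u₀ = u(0) ∈ L²`, in
`L^∞(0,T; L²)` with **every** slice `u(t)`, `t ∈ [0,T]`, in `L²` with `‖u(t)‖₂ ≤ M` and weakly
divergence free, weakly `L²`-continuous on `[0,T]`, in `L⁴(0,T; L⁴)`, with a jointly measurable
weak-gradient witness `Gu` of finite dissipation and a jointly measurable version `ũ`. Then for
every `t ∈ (0, T]`,
`‖u(t)‖₂² = ‖u₀‖₂² - 2ν ∫₀ᵗ Σᵢ ‖Gu(s) eᵢ‖₂² ds`.
Proof: the abstract doubling identity for `Q(s,σ) = ⟨u(s), u(σ)⟩` with both one-sided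
representations given by the `H¹_σ` time-slice identity
(`IsWeakNSSolutionOn.inner_weakGrad_test_eq_of_continuousOn`) tested with the slice `u(σ)`
(resp. `u(s)`); the gradient bulk terms converge to `-ν ∫₀ᵗ |∇u|²` each
(`tendsto_grad_of_dissipation`) and both trilinear bulk terms to `∫₀ᵗ b(u,u,u) ds`
(`tendsto_tri_L4`), which vanishes since `b(u(s),u(s),u(s)) = 0` for a.e. `s`
(`integral_inner_weakGrad_apply_self_eq_zero`, `L⁴ × L⁴ × L²`). [cite: Sohr2001, Ch. V Thm. 1.4.1] -/
theorem lions_identity (hE3 : Module.finrank ℝ E = 3) (hT : 0 < T)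
    (hu : IsWeakNSSolutionOn T ν 0 u₀ u) (hu₀ : MemLp u₀ 2 volume) (hu0 : u 0 = u₀)
    (hE : MemLqLp ∞ 2 u (Ioo 0 T)) {M : ℝ} (hM : 0 ≤ M)
    (hL2 : ∀ t ∈ Icc 0 T, MemLp (u t) 2 volume ∧ eLpNorm (u t) 2 volume ≤ ENNReal.ofReal M)
    (hdiv : ∀ t ∈ Icc 0 T, IsWeaklyDivFree (u t))
    (hcont : ∀ w : E → E, MemLp w 2 volume → ContinuousOn (fun t => ∫ x, ⟪u t x, w x⟫) (Icc 0 T))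
    (h4 : MemLqLp 4 4 u (Ioo 0 T))
    (hGum : StronglyMeasurable (uncurry Gu))
    (hGu : ∀ᵐ t ∂(volume.restrict (Ioo 0 T)), HasWeakGradient (u t) (Gu t))
    (hGu₂ : ∫⁻ t in Ioo 0 T, ∫⁻ x, ENNReal.ofReal (frobeniusNormSq (Gu t x)) < ⊤)
    (hutm : StronglyMeasurable ut)
    (hut : uncurry u =ᵐ[(volume.restrict (Ioo 0 T)).prod (volume : Measure E)] ut)
    {t : ℝ} (ht : t ∈ Ioc 0 T) :
    ∫ x, ⟪u t x, u t x⟫ = (∫ x, ⟪u₀ x, u₀ x⟫) -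
      2 * ν * ∫ s in Ioo 0 t, ∑ i, ∫ x,
        ⟪Gu s x (stdOrthonormalBasis ℝ E i), Gu s x (stdOrthonormalBasis ℝ E i)⟫ := by
  haveI : ENNReal.HolderTriple 4 4 2 := holderTriple_four_four_two
  obtain ⟨φ, hφ, h'φ⟩ := FunctionSpaces.exists_contDiffBump_seq (E := ℝ)
  set b := stdOrthonormalBasis ℝ E with hb
  have hb1 : ∀ i, ‖b i‖ = 1 := fun i => b.orthonormal.1 i
  set νt : Measure ℝ := volume.restrict (Ioo 0 t) with hνt
  haveI : IsFiniteMeasure νt := by rw [hνt]; infer_instance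
  have htT : Ioo (0 : ℝ) t ⊆ Ioo 0 T := Ioo_subset_Ioo le_rfl ht.2
  have hmono1 : νt ≤ volume.restrict (Ioo 0 T) := Measure.restrict_mono htT le_rfl
  have hmono2 : νt.prod νt ≤ (volume.restrict (Ioo 0 T)).prod (volume.restrict (Ioo 0 T)) :=
    Measure.prod_mono hmono1 hmono1
  have hum := hu.aestronglyMeasurable_uncurry
  have h4' : ∫⁻ s in Ioo 0 T, eLpNorm (u s) 4 volume ^ (2 : ℝ) < ⊤ :=
    lintegral_eLpNorm_four_sq_lt_top_of_memLqLp h4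
  have hut4 : eLpNorm ut 4 ((volume.restrict (Ioo 0 T)).prod (volume : Measure E)) < ⊤ :=
    eLpNorm_version_four_lt_top hum h4 hut
  have hL2' : ∀ t ∈ Icc 0 T, MemLp (u t) 2 volume := fun t ht => (hL2 t ht).1
  have hL2ae : ∀ᵐ s ∂(volume.restrict (Ioo 0 T)), MemLp (u s) 2 volume :=
    (ae_restrict_mem measurableSet_Ioo).mono fun s hs => hL2' s (Ioo_subset_Icc_self hs)
  -- ### the data of the doubling identity
  obtain ⟨Q, hQ⟩ : ∃ F : ℝ → ℝ → ℝ, F = fun s σ => ∫ x, ⟪u s x, u σ x⟫ := ⟨_, rfl⟩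
  obtain ⟨c, hc⟩ : ∃ F : ℝ → ℝ, F = fun σ => ∫ x, ⟪u₀ x, u σ x⟫ := ⟨_, rfl⟩
  obtain ⟨f, hf⟩ : ∃ F : ℝ → ℝ → ℝ, F = fun σ τ => (∫ x, ⟪Gu σ x (u τ x), u τ x⟫) -
      ν * ∑ i, ∫ x, ⟪Gu τ x (b i), Gu σ x (b i)⟫ := ⟨_, rfl⟩
  set Γ : ℝ := ∫ s in Ioo 0 t, ∑ i, ∫ x, ⟪Gu s x (b i), Gu s x (b i)⟫ with hΓ
  -- ### measurability of `Q`
  have hsu : ∀ᵐ s ∂νt, u s =ᵐ[volume] fun x => ut (s, x) :=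
    ae_restrict_Ioo_of_le ht.2 (ae_slice_eq_of_uncurry_ae_eq hut)
  have hQm : AEStronglyMeasurable (fun p : ℝ × ℝ => Q p.2 p.1) (νt.prod νt) := by
    have h1 : StronglyMeasurable fun p : ℝ × ℝ => ∫ x, ⟪ut (p.2, x), ut (p.1, x)⟫ := by
      have h2 : StronglyMeasurable fun z : (ℝ × ℝ) × E => ⟪ut (z.1.2, z.2), ut (z.1.1, z.2)⟫ :=
        (hutm.comp_measurable (measurable_fst.snd.prodMk measurable_snd)).inner (𝕜 := ℝ)
          (hutm.comp_measurable (measurable_fst.fst.prodMk measurable_snd))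
      exact h2.integral_prod_right'
    refine h1.aestronglyMeasurable.congr ?_
    filter_upwards [(Measure.quasiMeasurePreserving_fst (μ := νt) (ν := νt)).ae hsu,
      (Measure.quasiMeasurePreserving_snd (μ := νt) (ν := νt)).ae hsu] with p hp1 hp2
    rw [hQ]
    refine integral_congr_ae ?_
    filter_upwards [hp1, hp2] with x hx1 hx2
    rw [hx1, hx2]
  -- ### boundedness
  have hIoc : ∀ s ∈ Ioc 0 t, s ∈ Icc 0 T := fun s hs => ⟨hs.1.le, hs.2.trans ht.2⟩
  have hbd : ∀ s ∈ Icc 0 T, ∀ σ ∈ Icc 0 T, |∫ x, ⟪u s x, u σ x⟫| ≤ M ^ 2 := fun s hs σ hσ =>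
    abs_integral_inner_le_sq_of_eLpNorm_le hM (hL2 s hs).1 (hL2 σ hσ).1 (hL2 s hs).2 (hL2 σ hσ).2
  have hQb : ∀ s ∈ Ioc 0 t, ∀ σ ∈ Ioc 0 t, |Q s σ| ≤ M ^ 2 := fun s hs σ hσ => by
    rw [hQ]; exact hbd s (hIoc s hs) σ (hIoc σ hσ)
  have h0T : (0 : ℝ) ∈ Icc 0 T := ⟨le_rfl, hT.le⟩
  have hu₀M : eLpNorm u₀ 2 volume ≤ ENNReal.ofReal M := by rw [← hu0]; exact (hL2 0 h0T).2
  -- ### good times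
  have hD : ∀ᵐ σ ∂(volume.restrict (Ioo 0 T)), ∫⁻ x, ENNReal.ofReal (frobeniusNormSq (Gu σ x)) < ⊤ :=
    ae_lt_top (measurable_lintegral_frobeniusNormSq hGum) hGu₂.ne
  have hgood : ∀ᵐ σ ∂νt, HasWeakGradient (u σ) (Gu σ) ∧
      ∫⁻ x, ENNReal.ofReal (frobeniusNormSq (Gu σ x)) < ⊤ ∧ MemLp (u σ) 4 volume := by
    have h4ae : ∀ᵐ σ ∂(volume.restrict (Ioo 0 T)), MemLp (u σ) 4 volume := h4.1
    exact ae_restrict_Ioo_of_le ht.2 (by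
      filter_upwards [hGu, hD, h4ae] with σ h1 h2 h3
      exact ⟨h1, h2, h3⟩)
  -- ### the two representations (they coincide up to the symmetry of `Q`)
  have hrep : ∀ᵐ σ ∂νt, IntegrableOn (f σ) (Ioo 0 t) ∧
      ∀ s ∈ Ioc 0 t, ∫ x, ⟪u s x, u σ x⟫ = c σ + ∫ τ in Ioo 0 s, f σ τ := by
    filter_upwards [hgood, ae_restrict_mem measurableSet_Ioo] with σ hσ hσt
    obtain ⟨hGσ, hDσ, -⟩ := hσ
    have hσT : σ ∈ Icc 0 T := ⟨hσt.1.le, hσt.2.le.trans ht.2⟩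
    have hGσm : AEStronglyMeasurable (Gu σ) volume := hGσ.aestronglyMeasurable_deriv
    refine ⟨?_, fun s hs => ?_⟩
    · have h1 := integrableOn_weakFlux_of_L4 hum hL2ae h4' hGum hGu hGu₂ hGσm hDσ (ν := ν)
      rw [hf]
      exact h1.mono_set htT
    · have h1 := hu.inner_weakGrad_test_eq_of_continuousOn hE3 hT hE hL2' hcont hu₀ h4' hGum hGu hGu₂
        (hL2 σ hσT).1 (hdiv σ hσT) hGσ hDσ (t := s) ⟨hs.1.le, hs.2.trans ht.2⟩
      rw [hc, hf]
      dsimp only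
      rw [h1, setIntegral_congr_set Ioo_ae_eq_Ioc]
  have hA : ∀ᵐ σ ∂νt, IntegrableOn (f σ) (Ioo 0 t) ∧ ∀ s ∈ Ioc 0 t, Q s σ = c σ + ∫ τ in Ioo 0 s, f σ τ := by
    filter_upwards [hrep] with σ hσ
    refine ⟨hσ.1, fun s hs => ?_⟩
    rw [hQ]; exact hσ.2 s hs
  have hB : ∀ᵐ s ∂νt, IntegrableOn (f s) (Ioo 0 t) ∧ ∀ σ ∈ Ioc 0 t, Q s σ = c s + ∫ τ in Ioo 0 σ, f s τ := by
    filter_upwards [hrep] with s hs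
    refine ⟨hs.1, fun σ hσ => ?_⟩
    rw [hQ]
    dsimp only
    rw [integral_inner_comm (u s) (u σ)]
    exact hs.2 σ hσ
  -- ### continuity of the boundary data
  have hmemut : MemLp (u t) 2 volume := (hL2 t ⟨ht.1.le, ht.2⟩).1
  have hQ₁c : ContinuousOn (fun σ => Q t σ) (Ioc 0 T) := by
    have h1 := (hcont (u t) hmemut).mono (Ioc_subset_Icc_self)
    rw [hQ]
    refine h1.congr fun σ _ => ?_
    exact integral_inner_comm (u t) (u σ)
  have hQ₂c : ContinuousOn (fun s => Q s t) (Ioc 0 T) := by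
    have h1 := (hcont (u t) hmemut).mono (Ioc_subset_Icc_self)
    rw [hQ]
    exact h1
  have hcc' : ContinuousOn c (Icc 0 T) := by
    have h1 := hcont u₀ hu₀
    rw [hc]
    refine h1.congr fun σ _ => ?_
    exact integral_inner_comm u₀ (u σ)
  have hcc : ContinuousOn c (Ioc 0 T) := hcc'.mono Ioc_subset_Icc_self
  have hsubIoc : Ioo 0 t ⊆ Ioc 0 T := fun x hx => ⟨hx.1, hx.2.le.trans ht.2⟩
  have hc0 : Tendsto c (𝓝[>] 0) (𝓝 (∫ x, ⟪u₀ x, u₀ x⟫)) := by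
    have h1 : Tendsto c (𝓝[Icc 0 T] 0) (𝓝 (c 0)) := hcc' 0 h0T
    have hc0' : c 0 = ∫ x, ⟪u₀ x, u₀ x⟫ := by rw [hc]; simp only [hu0]
    rw [hc0'] at h1
    refine h1.mono_left ?_
    rw [← nhdsWithin_Ioo_eq_nhdsGT hT]
    exact nhdsWithin_mono _ Ioo_subset_Icc_self
  have hcb : ∀ σ ∈ Ioo 0 t, |c σ| ≤ M ^ 2 := by
    intro σ hσ
    rw [hc]
    have hσ' : σ ∈ Icc 0 T := ⟨hσ.1.le, hσ.2.le.trans ht.2⟩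
    have h := hbd 0 h0T σ hσ'
    rwa [hu0] at h
  -- ### integrability of the flux on the square
  set a : ℝ → ℝ := fun σ => ((∫⁻ x, ENNReal.ofReal (frobeniusNormSq (Gu σ x))) ^ (1 / 2 : ℝ)).toReal with ha
  set W : ℝ → ℝ≥0∞ := fun s => eLpNorm (u s) 4 volume ^ (2 : ℝ) + ENNReal.ofReal |ν| *
    ∑ i, eLpNorm (fun x => Gu s x (b i)) 2 volume with hW
  have hai : Integrable a νt := (integrable_toReal_sqrt_dissipation hGum hGu₂).mono_measure hmono1
  have hWfin : ∫⁻ s in Ioo 0 T, W s < ⊤ := lintegral_weight_lt_top_of_L4 hum h4' hGum hGu₂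
  have hWm : AEMeasurable W (volume.restrict (Ioo 0 T)) := by
    refine ((FunctionSpaces.aemeasurable_eLpNorm_slice hum 4).pow_const _).add
      (AEMeasurable.const_mul (Finset.aemeasurable_fun_sum _ fun i _ => ?_) _)
    have hm : AEStronglyMeasurable (uncurry fun s x => Gu s x (b i))
        ((volume.restrict (Ioo 0 T)).prod (volume : Measure E)) :=
      ((ContinuousLinearMap.apply ℝ E (b i)).continuous.comp_stronglyMeasurable hGum).aestronglyMeasurable
    exact FunctionSpaces.aemeasurable_eLpNorm_slice hm 2
  have hWi : Integrable (fun s => (W s).toReal) νt :=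
    (integrable_toReal_of_lintegral_ne_top hWm hWfin.ne).mono_measure hmono1
  -- pointwise bound `|f σ s| ≤ a σ * (W s).toReal` at good `(σ, s)`
  have hfb : ∀ᵐ p ∂(νt.prod νt), ‖f p.1 p.2‖ ≤ a p.1 * (W p.2).toReal := by
    have hσ := (Measure.quasiMeasurePreserving_fst (μ := νt) (ν := νt)).ae hgood
    have hs := (Measure.quasiMeasurePreserving_snd (μ := νt) (ν := νt)).ae hgood
    have hWs : ∀ᵐ s ∂νt, W s < ⊤ := ae_mono hmono1 (ae_lt_top' hWm hWfin.ne)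
    have hs' := (Measure.quasiMeasurePreserving_snd (μ := νt) (ν := νt)).ae hWs
    filter_upwards [hσ, hs, hs'] with p hp1 hp2 hp3
    obtain ⟨hG1, hD1, -⟩ := hp1
    obtain ⟨hG2, hD2, h42⟩ := hp2
    have hGi : ∀ i, MemLp (fun x => Gu p.2 x (b i)) 2 volume := fun i =>
      hG2.memLp_apply hD2 i
    have h := enorm_weakFlux_sub_le (A₂ := fun _ => 0) h42 hG2.aestronglyMeasurable_deriv hGi
      hG1.aestronglyMeasurable_deriv aestronglyMeasurable_const hD1 (by simp [frobeniusNormSq]) ν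
    simp only [zero_apply, inner_zero_left, inner_zero_right, integral_zero,
      Finset.sum_const_zero, mul_zero, sub_zero, sub_self] at h
    rw [hf]
    dsimp only
    have hne : (∫⁻ x, ENNReal.ofReal (frobeniusNormSq (Gu p.1 x))) ^ (1 / 2 : ℝ) * W p.2 ≠ ⊤ :=
      ENNReal.mul_ne_top (ENNReal.rpow_ne_top_of_nonneg (by norm_num) hD1.ne) hp3.ne
    have h' := (ENNReal.toReal_le_toReal enorm_ne_top hne).2 h
    rw [toReal_enorm, ENNReal.toReal_mul] at h'
    exact h'
  have hfm : AEStronglyMeasurable (fun p : ℝ × ℝ => f p.1 p.2) (νt.prod νt) := by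
    -- trilinear part through the version, gradient part through `integrable_sq_grad`
    have h1 : StronglyMeasurable fun p : ℝ × ℝ => ∫ x, ⟪Gu p.1 x (ut (p.2, x)), ut (p.2, x)⟫ :=
      stronglyMeasurable_integral_inner_apply hGum hutm hutm
    have h1' : AEStronglyMeasurable (fun p : ℝ × ℝ => ∫ x, ⟪Gu p.1 x (u p.2 x), u p.2 x⟫) (νt.prod νt) := by
      refine h1.aestronglyMeasurable.congr ?_
      filter_upwards [(Measure.quasiMeasurePreserving_snd (μ := νt) (ν := νt)).ae hsu] with p hp
      refine integral_congr_ae ?_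
      filter_upwards [hp] with x hx
      rw [hx]
    have h2 : AEStronglyMeasurable (fun p : ℝ × ℝ => ∑ i, ∫ x, ⟪Gu p.2 x (b i), Gu p.1 x (b i)⟫)
        (νt.prod νt) :=
      (integrable_finsetSum _ fun i _ => (integrable_sq_grad hGum hGum hGu₂ hGu₂ (b i) (hb1 i)).mono_measure
        hmono2).aestronglyMeasurable
    rw [hf]
    exact h1'.sub (h2.const_mul ν)
  have hfI : Integrable (fun p : ℝ × ℝ => f p.1 p.2) (νt.prod νt) :=
    (hai.mul_prod hWi).mono' hfm (hfb.mono fun p hp => by simpa using hp)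
  have hbdd : ∀ n {F : ℝ × ℝ → ℝ}, Integrable F (νt.prod νt) →
      Integrable (fun p => (φ n).normed volume (p.2 - p.1) * F p) (νt.prod νt) := by
    intro n F hF
    obtain ⟨C, hC0, hC⟩ := FunctionSpaces.exists_normed_le (φ n)
    exact hF.bdd_mul (c := C)
      ((φ n).continuous_normed.comp (continuous_snd.sub continuous_fst)).aestronglyMeasurable
      (ae_of_all _ fun p => by
        rw [Real.norm_eq_abs, abs_of_nonneg ((φ n).nonneg_normed _)]; exact hC _)
  have hfF : ∀ n, Integrable (fun p : ℝ × ℝ => (φ n).normed volume (p.2 - p.1) * f p.1 p.2) (νt.prod νt) :=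
    fun n => hbdd n hfI
  -- the `g`-side integrand is the swap of the `f`-side one (evenness of the kernel)
  have hswap : ∀ n, (fun p : ℝ × ℝ => (φ n).normed volume (p.2 - p.1) * f p.2 p.1) =
      fun p => (fun q : ℝ × ℝ => (φ n).normed volume (q.2 - q.1) * f q.1 q.2) p.swap := by
    intro n; funext p
    simp only [Prod.fst_swap, Prod.snd_swap]
    rw [← (φ n).normed_neg, neg_sub]
  have hgF : ∀ n, Integrable (fun p : ℝ × ℝ => (φ n).normed volume (p.2 - p.1) * f p.2 p.1) (νt.prod νt) := by
    intro n; rw [hswap n]; exact (hfF n).swap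
  -- ### the bulk limits
  -- gradient part
  have hIΓ : Integrable (fun p : ℝ × ℝ => ∑ i, ∫ x, ⟪Gu p.2 x (b i), Gu p.1 x (b i)⟫) (νt.prod νt) :=
    integrable_finsetSum _ fun i _ => (integrable_sq_grad hGum hGum hGu₂ hGu₂ (b i) (hb1 i)).mono_measure hmono2
  have hlimΓ := tendsto_grad_of_dissipation ht.2 hGum hGum hGu₂ hGu₂ hφ
  -- trilinear part: through the version, and its limit vanishes
  have hITA : Integrable (fun p : ℝ × ℝ => ∫ x, ⟪Gu p.1 x (u p.2 x), u p.2 x⟫) (νt.prod νt) := by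
    have h := hfI.add (hIΓ.const_mul ν)
    refine h.congr (ae_of_all _ fun p => ?_)
    rw [hf]
    simp only [Pi.add_apply]
    ring
  have hTAeq : ∀ᵐ s ∂νt, ∫ x, ⟪Gu s x (u s x), u s x⟫ = 0 := by
    filter_upwards [hgood, ae_restrict_mem measurableSet_Ioo] with s hs hst
    obtain ⟨hG1, hD1, h41⟩ := hs
    have hsT : s ∈ Icc 0 T := ⟨hst.1.le, hst.2.le.trans ht.2⟩
    exact integral_inner_weakGrad_apply_self_eq_zero (hdiv s hsT) hG1 hD1 (hL2 s hsT).1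
      (q := 4) (p := 4) (by norm_num) h41 h41
  have hlimA : Tendsto (fun n => ∫ p, (φ n).normed volume (p.2 - p.1) *
      (∫ x, ⟪Gu p.1 x (u p.2 x), u p.2 x⟫) ∂(νt.prod νt)) atTop (𝓝 0) := by
    have h := tendsto_tri_L4 ht.2 hutm hut4 hGum hGu₂ hφ
    have hlhs : ∀ n, (∫ p, (φ n).normed volume (p.2 - p.1) *
        (∫ x, ⟪Gu p.1 x (ut (p.2, x)), ut (p.2, x)⟫) ∂(νt.prod νt)) =
        ∫ p, (φ n).normed volume (p.2 - p.1) * (∫ x, ⟪Gu p.1 x (u p.2 x), u p.2 x⟫) ∂(νt.prod νt) := by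
      intro n
      refine integral_congr_ae ?_
      filter_upwards [(Measure.quasiMeasurePreserving_snd (μ := νt) (ν := νt)).ae hsu] with p hp
      congr 1
      refine integral_congr_ae ?_
      filter_upwards [hp] with x hx
      rw [hx]
    have hrhs : (∫ s in Ioo 0 t, ∫ x, ⟪Gu s x (ut (s, x)), ut (s, x)⟫) = 0 := by
      refine integral_eq_zero_of_ae ?_
      filter_upwards [hsu, hTAeq] with s hs h0
      rw [Pi.zero_apply, ← h0]
      refine integral_congr_ae ?_
      filter_upwards [hs] with x hx
      rw [hx]
    rw [hrhs] at h
    exact h.congr hlhs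
  have hf_lim : Tendsto (fun n => ∫ p, (φ n).normed volume (p.2 - p.1) * f p.1 p.2 ∂(νt.prod νt))
      atTop (𝓝 (0 - ν * Γ)) := by
    have h1 := hlimA.sub (hlimΓ.const_mul ν)
    refine h1.congr fun n => ?_
    rw [hf]
    dsimp only
    rw [← integral_const_mul, ← integral_sub (hbdd n hITA) ((hbdd n hIΓ).const_mul ν)]
    refine integral_congr_ae (ae_of_all _ fun p => ?_)
    ring
  have hg_lim : Tendsto (fun n => ∫ p, (φ n).normed volume (p.2 - p.1) * f p.2 p.1 ∂(νt.prod νt))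
      atTop (𝓝 (0 - ν * Γ)) := by
    refine hf_lim.congr fun n => ?_
    rw [hswap n]
    exact (integral_prod_swap (fun q : ℝ × ℝ => (φ n).normed volume (q.2 - q.1) * f q.1 q.2)).symm
  -- ### apply the doubling identity
  have hmain := FunctionSpaces.doubling_identity ht.1 hQm hQb hA hB (hQ₁c.mono hsubIoc)
    (tendsto_nhdsLT_of_continuousOn_Ioc ht.2 ht.1 hQ₁c) (hQ₂c.mono hsubIoc)
    (tendsto_nhdsLT_of_continuousOn_Ioc ht.2 ht.1 hQ₂c) (hcc.mono hsubIoc) hcb hc0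
    (hcc.mono hsubIoc) hcb hc0 hφ hfF hgF hf_lim hg_lim
  have hQtt : Q t t = ∫ x, ⟪u t x, u t x⟫ := by rw [hQ]
  rw [← hQtt, hmain]
  ring

end Lions

end Literature.Analysis.FluidPDE
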